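import Summits.BirchSwinnertonDyer.BirchSwinnertonDyer.Theorems.GenusKolyvaginAtTwoGenusPrimitiveSupplyAtTwoTwistingPrimeKolyvagin
import Summits.BirchSwinnertonDyer.BirchSwinnertonDyer.Theorems.GenusKolyvaginAtTwoGenusPrimitiveSupplyAtTwoTwistingPrimeDepth
import Summits.BirchSwinnertonDyer.BirchSwinnertonDyer.Theorems.KolyvaginRankRigidityAtTwoChebotarevTwoLevel
import Literature.NumberTheory.Automorphic.ChebotarevArtinRepHolds
import HarnessLib

/-!
# Route `GenusKolyvaginAtTwo`, crux #2 `GenusPrimitiveSupplyAtTwo` (stmt-BirchSwinnertonDyer-22136):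
# twisting primes at `2` of ANY DEPTH `M` for given classes — under NON-ENTANGLEMENT at level `2^M`

Width seat `bsd-line-gk2-p4` g8, cell `bsd-f1-sign2`; helper (`--supports stmt-BirchSwinnertonDyer-22136`),
seventh file of the twisting-prime series (g7: `…TwistingPrimeLocal`, `…TwistingPrime`, `…TwistingPrimeKolyvagin`,
`…TwistingPrimeDepth`, `…TwistingPrimeTwin`, `…TwistingPrimeGenusPair`). THEOREMS ONLY: no definition, no
named fact, no `sorry`; no item is closed; BSD is not proved by any of this.

WHY. The LEAD's «K ↔ K_ℓ symmetry» / AUXILIARY-FIELD form of the open kernel U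
(`Cruxes/GenusPrimitiveSupplyAtTwo/Lines/genus-supply-local.md` §2; `GenusKoly.multiGenusPrimitivityAtTwo_of_auxFieldPrimitive`,
p615396) consumes a DEPTH-2 Kolyvagin prime `ℓ` (`Frob_ℓ = c₀` on `E[4]`) together with a `2`-Selmer-TRIVIAL
even genus twist `E^{(ℓ*·d_K)}` — i.e. a depth-2 Kolyvagin prime at which the twin's Selmer class is NOT
strict (Mazur–Rubin Cor. 3.4 (i)). g7's series supplies such primes at depth ONE only and records
(`…TwistingPrimeKolyvagin`, header; memo `Lines/genus-supply-twisting-prime.md` §3 (iii)) that «depth ≥ 2 is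
NOT reachable by that argument (commutators leave `Γ_{ℚ(E[4])}`; Lawson–Wuthrich's class)», while the LEAD's
memo lists «the JOINT supply of such ℓ» as not kernel. THIS FILE settles the depth-`M` supply under the
exact hypothesis that makes it true:

* §16 DICHOTOMY (`forall_h1Eval_eq_zero_or_forall_exists_h1Eval_eq`): for `ρ̄_{W,2}` onto, `x ∈ H¹(ℚ, E[2])`
  and a conjugation-stable `B ≤ Γ_{ℚ(E[2])}`, either `[x, ·]` vanishes on `B` or it maps `B` ONTO `E[2]`;
  hence the KEY LEMMA AT ANY DEPTH (`exists_mem_smul_h1Eval_ne_of_exists_h1Eval_ne`, `…_pair_…`): if `[x, ·]`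
  does not vanish on `B` then some `h ∈ B` has `c₀[x,h] ≠ [x,h]` (`Δ < 0`); REDUCTION
  (`exists_torsionFixing_mem_h1Eval_ne_of_commutator_mem`): abelian side conditions are free — the
  hypothesis is INTRINSIC: «`x` does not die on `Γ_{ℚ(E[2^M])}`» (`x ∉ Inf H¹(Gal(ℚ(E[2^M])/ℚ), E[2])`),
  automatic at `M = 1` (`exists_torsionFixing_h1Eval_ne_of_ne_zero`, Prop. 9.1 at `2`), genuine at `M ≥ 2`
  (`H¹(GL₂(ℤ/4), 𝔽₂²) = 𝔽₂`: ONE inflated class — Lawson–Wuthrich; the cell's «entangled» twins,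
  `Lines/genus-supply-depthlaw.md` §2).
* §17 `exists_twistingPrime_pair_pow`: `Δ(W) < 0`, `ρ̄_{W,2}` onto, `x, y` not dying on `Γ_{ℚ(E[2^M])}`, `A`
  open commutator-closed, `m`, `B₀`, `S'` ⟹ a prime `ℓ ∉ B₀`, `ℓ ∤ m`, `m ∣ ℓ + 1`, Frobenius `c₀·t` with
  **`t ∈ Γ_{ℚ(E[2^M])} ∩ A`** (DEPTH `M`), and `x_ℓ ≠ 0`, `y_ℓ ≠ 0` — unconditional Čebotarev
  (`Automorphic.chebotarev_artinRep_holds` via `absoluteGaloisGroup.frobenius_dense`).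

Sequel files: `…TwistingPrimeDepthKolyvagin` (Kolyvagin primes of depth `M` with class control; the pair
`(E, E^{(d)})`; the GENUS PAIR at a depth-`M` Kolyvagin prime is Sel₂-minimal mod cor34i + non-entanglement)
and `…TwistingPrimeDepthOne` (depth one recovered; the Kummer reading of non-entanglement).

References: [MazurRubin2010] Prop. 3.3, Lemma 3.5; [GrossLMS1991] §9 (Prop. 9.1, 9.6); [McCallumLMS1991] §3
Cor. 3.2, §4; [LawsonWuthrich2016] Lemma 6; [SerreAbelianLadic1968] I §2.2.
-/

set_option linter.dupNamespace false -- tree convention: `Summit.BirchSwinnertonDyer.BirchSwinnertonDyer.Theorems` (summit = sub-problem)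
set_option autoImplicit false

noncomputable section

open scoped Classical Pointwise

namespace Summit.BirchSwinnertonDyer.BirchSwinnertonDyer.Theorems.GenusKolyTwistingPrime

open WeierstrassCurve NumberField IsDedekindDomain Field
open Literature.NumberTheory.GaloisRepresentations Literature.NumberTheory.EllipticCurves
open Literature.NumberTheory

/-! ## §16 The dichotomy for `[x, ·]` on a conjugation-stable subgroup of `Γ_{ℚ(E[2])}`; the depth-`M`
key lemma under non-entanglement -/

section Dichotomy

variable (W : WeierstrassCurve ℚ) [W.IsElliptic]

/-- **DICHOTOMY.** Let `ρ̄_{W,2}` be onto, `x ∈ H¹(ℚ, E[2])`, and `B ≤ Γ_{ℚ(E[2])}` a subgroup stable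
under conjugation by `Γ_ℚ` (e.g. `Γ_F` for a finite Galois `F ⊇ ℚ(E[2])`: `Γ_{ℚ(E[2^M], μ_m)} ∩ Γ_K ∩ …`).
Then EITHER `[x, h] = 0` for every `h ∈ B` (the restriction of `x` to `B` vanishes: `x` is inflated
from `Γ_ℚ/B`), OR `h ↦ [x, h]` maps `B` ONTO `E[2]`. (The image is a `Γ_ℚ`-stable subgroup of `E[2]`
by `[x, σhσ⁻¹] = σ[x, h]`, and `Γ_ℚ` is transitive on `E[2] ∖ 0`.) [cite: GrossLMS1991, §9 (pairing after Prop. 9.1)]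
[cite: MazurRubin2010, Lemma 3.5] -/
theorem forall_h1Eval_eq_zero_or_forall_exists_h1Eval_eq (hsurj : W.HasSurjectiveModNGaloisRep 2)
    (x : galH1Torsion W (2 : ℤ)) (B : Subgroup (absoluteGaloisGroup ℚ))
    (hBT : B ≤ torsionFixing W (2 : ℤ))
    (hBconj : ∀ (σ : absoluteGaloisGroup ℚ) {h : absoluteGaloisGroup ℚ}, h ∈ B → σ * h * σ⁻¹ ∈ B) :
    (∀ h ∈ B, h1Eval W (2 : ℤ) x h = 0) ∨
      (∀ P : geomTorsion W (2 : ℤ), ∃ h ∈ B, h1Eval W (2 : ℤ) x h = P) := by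
  by_cases hall : ∀ h ∈ B, h1Eval W (2 : ℤ) x h = 0
  · exact Or.inl hall
  refine Or.inr fun P ↦ ?_
  push Not at hall
  obtain ⟨h₁, hh₁B, hv₁⟩ := hall
  by_cases hP0 : P = 0
  · exact ⟨1, B.one_mem, by rw [hP0, h1Eval_one]⟩
  have hsurj' : W.HasSurjectiveModNGaloisRep ((2 : ℕ) : ℤ) := by simpa using hsurj
  have h2Q : ((2 : ℕ) : ℚ) ≠ 0 := by norm_num
  obtain ⟨σ, hσ⟩ := exists_smul_eq_of_hasSurjectiveModNGaloisRep W 2 h2Q hsurj' hv₁ hP0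
  exact ⟨σ * h₁ * σ⁻¹, hBconj σ hh₁B, by rw [h1Eval_conj W _ x σ (hBT hh₁B), hσ]⟩

/-- **KEY LEMMA AT ANY DEPTH, under non-entanglement.** `ρ̄_{W,2}` onto, `Δ(W) < 0`, `c₀` a complex
conjugation, `x ∈ H¹(ℚ, E[2])`, `B ≤ Γ_{ℚ(E[2])}` conjugation-stable. IF some `h ∈ B` has `[x, h] ≠ 0`
(«`x` is not inflated from `Γ_ℚ/B`»), THEN some `h ∈ B` has `c₀ • [x, h] ≠ [x, h]`: by the dichotomy
`[x, ·]` maps `B` onto `E[2]`, and `c₀` moves a point of `E[2]` when `Δ < 0`. For `B = Γ_{ℚ(E[2], μ_m)} ∩ A`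
the hypothesis is automatic for `x ≠ 0` (`exists_torsionFixing_mem_smul_h1Eval_ne`, commutators); for
`B ⊆ Γ_{ℚ(E[4])}` it is a genuine condition (Lawson–Wuthrich's inflated class; the cell's «entangled»
curves). [cite: MazurRubin2010, Lemma 3.5 and Prop. 3.3 (choice of twisting primes)] [cite: GrossLMS1991, §9 Prop. 9.1]
[cite: LawsonWuthrich2016, Lemma 6] -/
theorem exists_mem_smul_h1Eval_ne_of_exists_h1Eval_ne (hsurj : W.HasSurjectiveModNGaloisRep 2)
    (hΔ : W.Δ < 0) {c₀ : absoluteGaloisGroup ℚ} (hc₀ : IsComplexConjugation (Rat.castHom ℝ) c₀)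
    (x : galH1Torsion W (2 : ℤ)) (B : Subgroup (absoluteGaloisGroup ℚ))
    (hBT : B ≤ torsionFixing W (2 : ℤ))
    (hBconj : ∀ (σ : absoluteGaloisGroup ℚ) {h : absoluteGaloisGroup ℚ}, h ∈ B → σ * h * σ⁻¹ ∈ B)
    (hne : ∃ h ∈ B, h1Eval W (2 : ℤ) x h ≠ 0) :
    ∃ h ∈ B, c₀ • h1Eval W (2 : ℤ) x h ≠ h1Eval W (2 : ℤ) x h := by
  rcases forall_h1Eval_eq_zero_or_forall_exists_h1Eval_eq W hsurj x B hBT hBconj with h0 | honto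
  · obtain ⟨h, hhB, hh⟩ := hne
    exact absurd (h0 h hhB) hh
  obtain ⟨v, hv⟩ : ∃ v : geomTorsion W (2 : ℤ), c₀ • v ≠ v :=
    KolyvaginEigenTwo.exists_twoTorsion_smul_ne_of_Δ_neg W hΔ hc₀
  obtain ⟨h, hhB, hh⟩ := honto v
  exact ⟨h, hhB, by rw [hh]; exact hv⟩

/-- **Two classes at once, at any depth.** If `[x, ·]` and `[y, ·]` are both non-zero somewhere on the
conjugation-stable `B ≤ Γ_{ℚ(E[2])}`, ONE `h ∈ B` has `c₀ • [x, h] ≠ [x, h]` and `c₀ • [y, h] ≠ [y, h]`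
(a group is not the union of two proper subgroups). [cite: MazurRubin2010, Lemma 3.5 and Prop. 3.3 (choice of twisting primes)] -/
theorem exists_mem_smul_h1Eval_ne_pair_of_exists_h1Eval_ne (hsurj : W.HasSurjectiveModNGaloisRep 2)
    (hΔ : W.Δ < 0) {c₀ : absoluteGaloisGroup ℚ} (hc₀ : IsComplexConjugation (Rat.castHom ℝ) c₀)
    (x y : galH1Torsion W (2 : ℤ)) (B : Subgroup (absoluteGaloisGroup ℚ))
    (hBT : B ≤ torsionFixing W (2 : ℤ))
    (hBconj : ∀ (σ : absoluteGaloisGroup ℚ) {h : absoluteGaloisGroup ℚ}, h ∈ B → σ * h * σ⁻¹ ∈ B)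
    (hx : ∃ h ∈ B, h1Eval W (2 : ℤ) x h ≠ 0) (hy : ∃ h ∈ B, h1Eval W (2 : ℤ) y h ≠ 0) :
    ∃ h ∈ B, c₀ • h1Eval W (2 : ℤ) x h ≠ h1Eval W (2 : ℤ) x h ∧
      c₀ • h1Eval W (2 : ℤ) y h ≠ h1Eval W (2 : ℤ) y h := by
  -- the subgroup of `Γ_{ℚ(E[2])}` on which `c₀` fixes `[z, ·]`
  let Kz : galH1Torsion W (2 : ℤ) → Subgroup (absoluteGaloisGroup ℚ) := fun z ↦
    { carrier := {h | h ∈ torsionFixing W (2 : ℤ) ∧ c₀ • h1Eval W (2 : ℤ) z h = h1Eval W (2 : ℤ) z h}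
      one_mem' := ⟨one_mem _, by rw [h1Eval_one, smul_zero]⟩
      mul_mem' := by
        rintro a b ⟨ha, ha'⟩ ⟨hb, hb'⟩
        exact ⟨mul_mem ha hb, by rw [h1Eval_mul W _ z ha, smul_add, ha', hb']⟩
      inv_mem' := by
        rintro a ⟨ha, ha'⟩
        exact ⟨inv_mem ha, by rw [h1Eval_inv W _ z ha, smul_neg, ha']⟩ }
  have hKz : ∀ (z : galH1Torsion W (2 : ℤ)) (h : absoluteGaloisGroup ℚ), h ∈ Kz z ↔
      h ∈ torsionFixing W (2 : ℤ) ∧ c₀ • h1Eval W (2 : ℤ) z h = h1Eval W (2 : ℤ) z h :=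
    fun z h ↦ Iff.rfl
  have hex : ∀ z : galH1Torsion W (2 : ℤ), (∃ h ∈ B, h1Eval W (2 : ℤ) z h ≠ 0) →
      ∃ a ∈ B, a ∉ Kz z := fun z hz ↦ by
    obtain ⟨h, hhB, hh⟩ :=
      exists_mem_smul_h1Eval_ne_of_exists_h1Eval_ne W hsurj hΔ hc₀ z B hBT hBconj hz
    exact ⟨h, hhB, fun hK ↦ hh ((hKz z h).mp hK).2⟩
  obtain ⟨g, hgB, hgx, hgy⟩ := exists_mem_not_mem_not_mem (hex x hx) (hex y hy)
  exact ⟨g, hgB, fun h ↦ hgx ((hKz x g).mpr ⟨hBT hgB, h⟩), fun h ↦ hgy ((hKz y g).mpr ⟨hBT hgB, h⟩)⟩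

/-- **REDUCTION: abelian side conditions are free.** If `[x, ·]` does not vanish on `Γ_{ℚ(E[n])}`
(`2 ∣ n`; `ρ̄_{W,2}` onto) then it does not vanish on `Γ_{ℚ(E[n])} ∩ A` for ANY subgroup `A ≤ Γ_ℚ`
containing all commutators (the fixer of an abelian extension: roots of unity, `K`, square roots, …).
Indeed if it did, then for `ρ ∈ Γ_{ℚ(E[n])}` and `γ ∈ Γ_ℚ` the commutator `γργ⁻¹ρ⁻¹ ∈ Γ_{ℚ(E[n])} ∩ A`
gives `γ[x,ρ] − [x,ρ] = 0`, so every value `[x, ρ]` is `Γ_ℚ`-fixed, hence `0`. Consequently the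
non-entanglement hypothesis of this file is INTRINSIC to `ℚ(E[2^M])`: «`x` does not die on
`Γ_{ℚ(E[2^M])}`», i.e. `x ∉ Inf H¹(Gal(ℚ(E[2^M])/ℚ), E[2])`. [cite: GrossLMS1991, §9 Prop. 9.1]
[cite: MazurRubin2010, Lemma 3.5] -/
theorem exists_torsionFixing_mem_h1Eval_ne_of_commutator_mem (hsurj : W.HasSurjectiveModNGaloisRep 2)
    {n : ℤ} (hn : (2 : ℤ) ∣ n) {x : galH1Torsion W (2 : ℤ)}
    (hne : ∃ h ∈ torsionFixing W n, h1Eval W (2 : ℤ) x h ≠ 0)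
    (A : Subgroup (absoluteGaloisGroup ℚ)) (hA : ∀ γ δ : absoluteGaloisGroup ℚ, γ * δ * γ⁻¹ * δ⁻¹ ∈ A) :
    ∃ h ∈ torsionFixing W n, h ∈ A ∧ h1Eval W (2 : ℤ) x h ≠ 0 := by
  have hT : torsionFixing W n ≤ torsionFixing W (2 : ℤ) := KolyvaginLowerBoundAtTwo.torsionFixing_le_of_dvd W hn
  by_contra hcon
  push Not at hcon
  obtain ⟨ρ, hρ, hρx⟩ := hne
  apply hρx
  apply eq_zero_of_forall_smul_eq W hsurj
  intro γ
  have hc1 : γ * ρ * γ⁻¹ ∈ torsionFixing W n := (torsionFixing_normal W _).conj_mem ρ hρ γ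
  have hcomm : γ * ρ * γ⁻¹ * ρ⁻¹ ∈ torsionFixing W n := mul_mem hc1 (inv_mem hρ)
  have h0 := hcon _ hcomm (hA γ ρ)
  rw [h1Eval_mul W _ x (hT hc1), h1Eval_conj W _ x γ (hT hρ), h1Eval_inv W _ x (hT hρ),
    add_neg_eq_zero] at h0
  exact h0

/-- **At depth ONE the non-entanglement hypothesis is automatic**: `x ≠ 0` does not die on
`Γ_{ℚ(E[2])}` when `ρ̄_{W,2}` is onto (Gross's Prop. 9.1 at `2` over `ℚ`, `h1_restriction_injective_two_rat`:
`H¹(GL₂(𝔽₂), 𝔽₂²) = 0`). So the depth-`M` theorems below contain the depth-one ones of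
`…TwistingPrime*`; at `M ≥ 2` the hypothesis is genuine (`H¹(GL₂(ℤ/4), 𝔽₂²) ≠ 0`: Lawson–Wuthrich's
class; the cell's «entangled» twins, `Lines/genus-supply-depthlaw.md` §2). [cite: GrossLMS1991, §9 Prop. 9.1]
[cite: LawsonWuthrich2016, Lemma 6] -/
theorem exists_torsionFixing_h1Eval_ne_of_ne_zero (hsurj : W.HasSurjectiveModNGaloisRep 2)
    {x : galH1Torsion W (2 : ℤ)} (hx : x ≠ 0) :
    ∃ h ∈ torsionFixing W (2 : ℤ), h1Eval W (2 : ℤ) x h ≠ 0 := by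
  by_contra hcon
  push Not at hcon
  exact hx (h1_restriction_injective_two_rat W hsurj hcon)

end Dichotomy

/-! ## §17 Twisting primes of depth `M` for two classes (Frobenius `c₀·t`, `t ∈ Γ_{ℚ(E[2^M])} ∩ A`) -/

section DepthPair

variable (W : WeierstrassCurve ℚ) [W.IsElliptic]

/-- **TWISTING PRIMES AT `2` OF DEPTH `M` FOR TWO CLASSES, under non-entanglement at level `2^M`.**
`W/ℚ` elliptic, `Δ(W) < 0`, `ρ̄_{W,2}` onto, `c₀` a complex conjugation, `M ≥ 1`, `x, y ∈ H¹(ℚ, E[2])`,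
`A ≤ Γ_ℚ` OPEN containing all commutators (the fixer of a finite abelian extension `F_A/ℚ`), `m ≥ 1`, a
finite set `B₀` of rational primes and a finite set `S'` of places to avoid. HYPOTHESIS (non-entanglement
at level `2^M`): `[x, h] ≠ 0` for some `h ∈ Γ_{ℚ(E[2^M])}` and `[y, h'] ≠ 0` for some `h' ∈ Γ_{ℚ(E[2^M])}` —
neither class is inflated from `Gal(ℚ(E[2^M])/ℚ)`; automatic for `M = 1` and `x, y ≠ 0`
(`exists_torsionFixing_h1Eval_ne_of_ne_zero`); the side conditions `A`, `μ_m` cost nothing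
(`exists_torsionFixing_mem_h1Eval_ne_of_commutator_mem`). CONCLUSION: a prime `ℓ ∉ B₀`, `ℓ ∤ m`,
`m ∣ ℓ + 1`, a place `v ∋ ℓ` off `S'` with an arithmetic Frobenius `c₀·t`, **`t ∈ Γ_{ℚ(E[2^M])} ∩ A`** (so
`Frob_ℓ` acts as `c₀` on `E[2^M]` — DEPTH `M`: `2^M ∣ ℓ + 1`, `2^M ∣ a_ℓ` — and on everything `A` fixes),
and BOTH `x_ℓ ≠ 0`, `y_ℓ ≠ 0` in `H¹(ℚ_ℓ, E[2])`. Proof: the depth-`M` two-class key lemma on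
`B = Γ_{ℚ(E[2^M], ζ_m)} ∩ A` gives `h₀ ∈ B` with `c₀[z,h₀] ≠ [z,h₀]` (`z = x, y`); Čebotarev (`frobenius_dense`,
proved in the tree) in the open set `c₀h₀·(𝒩_{x,y} ∩ Stab ζ_m ∩ A ∩ Γ_{ℚ(E[2^M])})`; then `m ∣ ℓ + 1` from
`γζ = ζ⁻¹ = ζ^ℓ`, and `[z, γ²] = c₀[z,h₀] + [z,h₀] ≠ 0 ⟹ z_ℓ ≠ 0` (easy half of the local criterion),
exactly as at depth one. This is the Čebotarev half of the LEVEL LAW's prime-level supply at depth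
`M ≥ 2` (`Lines/genus-supply-depthlaw.md` §2–§3, `Lines/genus-supply-local.md` §2), out of reach of the
depth-one argument (`…TwistingPrimeKolyvagin`, header). [cite: MazurRubin2010, Prop. 3.3 and Lemma 3.5 (twisting primes via Čebotarev)]
[cite: GrossLMS1991, §9 Prop. 9.6] [cite: McCallumLMS1991, §3 Cor. 3.2, §4 (Kolyvagin primes of level M)] -/
theorem exists_twistingPrime_pair_pow (hsurj : W.HasSurjectiveModNGaloisRep 2) (hΔ : W.Δ < 0)
    {c₀ : absoluteGaloisGroup ℚ} (hc₀ : IsComplexConjugation (Rat.castHom ℝ) c₀) {M : ℕ} (hM : 1 ≤ M)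
    {x y : galH1Torsion W (2 : ℤ)}
    (A : Subgroup (absoluteGaloisGroup ℚ)) (hAopen : IsOpen (A : Set (absoluteGaloisGroup ℚ)))
    (hA : ∀ γ δ : absoluteGaloisGroup ℚ, γ * δ * γ⁻¹ * δ⁻¹ ∈ A)
    {m : ℕ} (hm : m ≠ 0)
    (hx : ∃ h ∈ torsionFixing W ((2 ^ M : ℕ) : ℤ), h1Eval W (2 : ℤ) x h ≠ 0)
    (hy : ∃ h ∈ torsionFixing W ((2 ^ M : ℕ) : ℤ), h1Eval W (2 : ℤ) y h ≠ 0)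
    (B₀ : Finset ℕ) {S' : Set (HeightOneSpectrum (𝓞 ℚ))} (hS' : S'.Finite) :
    ∃ ℓ : ℕ, ∃ _ : Fact ℓ.Prime, ℓ ∉ B₀ ∧ ¬ ℓ ∣ m ∧ m ∣ ℓ + 1 ∧
      (∃ (v : HeightOneSpectrum (𝓞 ℚ)) (𝔓 : Ideal (absIntegers (𝓞 ℚ) ℚ))
          (t : absoluteGaloisGroup ℚ), v ∉ S' ∧ (ℓ : 𝓞 ℚ) ∈ v.asIdeal ∧ 𝔓 ∈ v.primesAbove ∧
          IsArithFrobAt (𝓞 ℚ) (c₀ * t) 𝔓 ∧ t ∈ torsionFixing W ((2 ^ M : ℕ) : ℤ) ∧ t ∈ A) ∧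
      x ∉ W.torsionLocalKer ℚ_[ℓ] (2 : ℤ) ∧ y ∉ W.torsionLocalKer ℚ_[ℓ] (2 : ℤ) := by
  classical
  haveI : NeZero m := ⟨hm⟩
  have hn0 : (2 : ℤ) ≠ 0 := two_ne_zero
  have hnM0 : ((2 ^ M : ℕ) : ℤ) ≠ 0 := by exact_mod_cast pow_ne_zero M two_ne_zero
  -- `Γ_{ℚ(E[2^M])} ≤ Γ_{ℚ(E[2])}`
  set TM := torsionFixing W ((2 ^ M : ℕ) : ℤ) with hTMdef
  have h2M : (2 : ℤ) ∣ ((2 ^ M : ℕ) : ℤ) := by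
    rw [Nat.cast_pow, Nat.cast_ofNat]; exact dvd_pow_self 2 (by omega : M ≠ 0)
  have hTM : TM ≤ torsionFixing W (2 : ℤ) := KolyvaginLowerBoundAtTwo.torsionFixing_le_of_dvd W h2M
  have hTMopen : IsOpen (TM : Set (absoluteGaloisGroup ℚ)) := isOpen_torsionFixing W hnM0
  -- a primitive `m`-th root of unity
  have hq0 : ((m : ℕ) : AlgebraicClosure ℚ) ≠ 0 := by exact_mod_cast hm
  haveI : NeZero ((m : ℕ) : AlgebraicClosure ℚ) := ⟨hq0⟩
  obtain ⟨ζ, hζ⟩ := IsAlgClosed.exists_root (Polynomial.cyclotomic m (AlgebraicClosure ℚ))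
    (Polynomial.degree_cyclotomic_pos m _ (Nat.pos_of_ne_zero hm)).ne'
  have hprim : IsPrimitiveRoot ζ m := Polynomial.isRoot_cyclotomic_iff.mp hζ
  have hpow : ∀ σ : absoluteGaloisGroup ℚ, ∃ i : ℕ, σ • ζ = ζ ^ i := fun σ ↦ by
    have h1 : (σ • ζ) ^ m = 1 := by rw [← smul_pow', hprim.pow_eq_one, smul_one]
    obtain ⟨i, -, hi⟩ := hprim.eq_pow_of_pow_eq_one h1
    exact ⟨i, hi.symm⟩
  set St : Subgroup (absoluteGaloisGroup ℚ) := MulAction.stabilizer (absoluteGaloisGroup ℚ) ζ with hSt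
  have hStopen : IsOpen (St : Set (absoluteGaloisGroup ℚ)) := isOpen_stabilizer_absoluteGaloisGroup ζ
  have hStconj : ∀ (σ : absoluteGaloisGroup ℚ) {h : absoluteGaloisGroup ℚ}, h ∈ St →
      σ * h * σ⁻¹ ∈ St := by
    intro σ h hh
    change (σ * h * σ⁻¹) • ζ = ζ
    have hh' : h • ζ = ζ := hh
    obtain ⟨i, hi⟩ := hpow σ⁻¹
    rw [mul_smul, mul_smul, hi, smul_pow', hh', ← hi, smul_inv_smul]
  -- ### abelian side conditions are free: move the witnesses into `Stab ζ ⊓ A` (commutator-closed)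
  set A' : Subgroup (absoluteGaloisGroup ℚ) := St ⊓ A with hA'
  have hA'comm : ∀ γ δ : absoluteGaloisGroup ℚ, γ * δ * γ⁻¹ * δ⁻¹ ∈ A' := fun γ δ ↦
    ⟨commutator_smul_rootOfUnity hprim γ δ, hA γ δ⟩
  -- ### the conjugation-stable subgroup `B = Γ_{ℚ(E[2^M], ζ)} ∩ A` and the two-class key lemma on it
  set B : Subgroup (absoluteGaloisGroup ℚ) := TM ⊓ A' with hB
  have hBT : B ≤ torsionFixing W (2 : ℤ) := fun h hh ↦ hTM hh.1
  have hBconj : ∀ (σ : absoluteGaloisGroup ℚ) {h : absoluteGaloisGroup ℚ}, h ∈ B → σ * h * σ⁻¹ ∈ B :=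
    fun σ h hh ↦ ⟨(torsionFixing_normal W _).conj_mem h hh.1 σ,
      ⟨hStconj σ hh.2.1, conj_mem_of_commutator_mem hA σ hh.2.2⟩⟩
  have hx' : ∃ h ∈ B, h1Eval W (2 : ℤ) x h ≠ 0 := by
    obtain ⟨h, hT, hA'', hh⟩ := exists_torsionFixing_mem_h1Eval_ne_of_commutator_mem W hsurj h2M hx A' hA'comm
    exact ⟨h, ⟨hT, hA''⟩, hh⟩
  have hy' : ∃ h ∈ B, h1Eval W (2 : ℤ) y h ≠ 0 := by
    obtain ⟨h, hT, hA'', hh⟩ := exists_torsionFixing_mem_h1Eval_ne_of_commutator_mem W hsurj h2M hy A' hA'comm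
    exact ⟨h, ⟨hT, hA''⟩, hh⟩
  obtain ⟨h₀, hh₀B, hh₀x, hh₀y⟩ :=
    exists_mem_smul_h1Eval_ne_pair_of_exists_h1Eval_ne W hsurj hΔ hc₀ x y B hBT hBconj hx' hy'
  have hh₀TM : h₀ ∈ TM := hh₀B.1
  have hh₀T : h₀ ∈ torsionFixing W (2 : ℤ) := hTM hh₀TM
  have hh₀ζ : h₀ • ζ = ζ := hh₀B.2.1
  have hh₀A : h₀ ∈ A := hh₀B.2.2
  -- ### the finite exceptional set of places of `ℚ`
  set Bx : Finset ℕ := m.primeFactors ∪ B₀ with hBx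
  set S : Set (HeightOneSpectrum (𝓞 ℚ)) :=
    {v | ∃ q ∈ Bx, q.Prime ∧ (q : 𝓞 ℚ) ∈ v.asIdeal} ∪ S' with hS
  have hSfin : S.Finite := by
    refine Set.Finite.union ?_ hS'
    have : {v : HeightOneSpectrum (𝓞 ℚ) | ∃ q ∈ Bx, q.Prime ∧ (q : 𝓞 ℚ) ∈ v.asIdeal} ⊆
        ⋃ q ∈ (Bx.filter Nat.Prime), {v | (q : 𝓞 ℚ) ∈ v.asIdeal} := by
      intro v ⟨q, hqB, hq, hqv⟩
      simp only [Set.mem_iUnion, Finset.mem_filter]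
      exact ⟨q, ⟨hqB, hq⟩, hqv⟩
    refine Set.Finite.subset (Set.Finite.biUnion (Finset.finite_toSet _) fun q hq ↦ ?_) this
    rw [Finset.coe_filter, Set.mem_setOf_eq] at hq
    have hsub : {v : HeightOneSpectrum (𝓞 ℚ) | (q : 𝓞 ℚ) ∈ v.asIdeal}.Subsingleton :=
      fun v hv v' hv' ↦ HeightOneSpectrum.eq_of_natCast_mem_rat hq.2 hv hv'
    exact hsub.finite
  -- ### Čebotarev: a Frobenius in the open set `c₀ h₀ · (𝒩 ∩ Stab ζ ∩ A ∩ Γ_{ℚ(E[2^M])})`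
  set xs : Bool → galH1Torsion W (2 : ℤ) := fun i ↦ if i then x else y with hxs
  set 𝒩 := evalKer W (2 : ℤ) xs with h𝒩
  have h𝒩open : IsOpen (𝒩 : Set (absoluteGaloisGroup ℚ)) :=
    isOpen_evalKer W _ _ (isOpen_torsionFixing W hn0)
  set U : Set (absoluteGaloisGroup ℚ) :=
    (((𝒩 : Set _) ∩ (St : Set _)) ∩ (A : Set _)) ∩ (TM : Set _) with hU
  have hUopen : IsOpen U := ((h𝒩open.inter hStopen).inter hAopen).inter hTMopen
  set O : Set (absoluteGaloisGroup ℚ) := (fun γ ↦ c₀ * h₀ * γ) '' U with hO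
  have hOopen : IsOpen O := (Homeomorph.mulLeft (c₀ * h₀)).isOpenMap _ hUopen
  have hOne : O.Nonempty := ⟨c₀ * h₀ * 1, 1, ⟨⟨⟨𝒩.one_mem, St.one_mem⟩, A.one_mem⟩, TM.one_mem⟩, rfl⟩
  obtain ⟨γ, hγO, v, hvS, 𝔓₀, h𝔓₀, hγ⟩ :=
    (absoluteGaloisGroup.frobenius_dense Automorphic.chebotarev_artinRep_holds ℚ S hSfin
      ).inter_open_nonempty O hOopen hOne
  obtain ⟨u, ⟨⟨⟨hu𝒩, huSt⟩, huA⟩, huTM⟩, rfl⟩ := hγO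
  have hux : h1Eval W (2 : ℤ) x u = 0 := by simpa [hxs] using hu𝒩.2 true
  have huy : h1Eval W (2 : ℤ) y u = 0 := by simpa [hxs] using hu𝒩.2 false
  have huζ : u • ζ = ζ := huSt
  set t := h₀ * u with ht
  have htTM : t ∈ TM := mul_mem hh₀TM huTM
  have htT : t ∈ torsionFixing W (2 : ℤ) := hTM htTM
  have htA : t ∈ A := mul_mem hh₀A huA
  have hγt : c₀ * h₀ * u = c₀ * t := by rw [ht, mul_assoc]
  have hvS' : v ∉ S' := fun h ↦ hvS (Or.inr h)
  -- ### the rational prime `ℓ` under `v` and `ℚ_v ≅ ℚ_ℓ`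
  set ℓ : ℕ := (Rat.HeightOneSpectrum.primesEquiv (R := 𝓞 ℚ) v : ℕ) with hℓdef
  have hℓ : ℓ.Prime := (Rat.HeightOneSpectrum.primesEquiv (R := 𝓞 ℚ) v).2
  haveI hℓF : Fact ℓ.Prime := ⟨hℓ⟩
  have hℓv : (ℓ : 𝓞 ℚ) ∈ v.asIdeal := by
    have h := (Rat.HeightOneSpectrum.natGenerator_dvd_iff (R := 𝓞 ℚ) v (n := ℓ)).mp dvd_rfl
    rw [Ideal.mem_map_iff_of_surjective _ (Rat.IsIntegralClosure.intEquiv (𝓞 ℚ)).surjective] at h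
    obtain ⟨z, hz, hzℓ⟩ := h
    have : z = (ℓ : 𝓞 ℚ) :=
      (Rat.IsIntegralClosure.intEquiv (𝓞 ℚ)).injective (by rw [hzℓ, map_natCast])
    rwa [this] at hz
  haveI : CharZero (v.adicCompletion ℚ) :=
    charZero_of_injective_algebraMap (algebraMap ℚ (v.adicCompletion ℚ)).injective
  set θ : v.adicCompletion ℚ ≃+* ℚ_[ℓ] :=
    RingEquivClass.toRingEquiv (Rat.HeightOneSpectrum.adicCompletion.padicEquiv (R := 𝓞 ℚ) v)
    with hθ
  have hℓB : ℓ ∉ Bx := fun h ↦ hvS (Or.inl ⟨ℓ, h, hℓ, hℓv⟩)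
  simp only [hBx, Finset.mem_union, Nat.mem_primeFactors, not_or] at hℓB
  obtain ⟨hℓm', hℓB₀⟩ := hℓB
  have hℓm : ¬ ℓ ∣ m := fun h ↦ hℓm' ⟨hℓ, h, hm⟩
  -- ### `m ∣ ℓ + 1`
  have hmv : (m : 𝓞 ℚ) ∉ v.asIdeal := natCast_not_mem_of_not_dvd hℓ hℓv hℓm
  have h1 : (c₀ * h₀ * u) • ζ = ζ⁻¹ := by
    rw [mul_smul, mul_smul, huζ, hh₀ζ, RatClosure.smul_eq_inv_of_pow_eq_one hc₀ hm hprim.pow_eq_one]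
  have h2 : (c₀ * h₀ * u) • ζ = ζ ^ v.residueCard :=
    smul_eq_pow_residueCard_of_isArithFrobAt_of_pow_eq_one hmv h𝔓₀ hγ hprim.pow_eq_one
  rw [residueCard_eq_of_natCast_mem_rat hℓ hℓv, h1] at h2
  have hζ0 : ζ ≠ 0 := hprim.ne_zero hm
  have hζ1 : ζ ^ (ℓ + 1) = 1 := by rw [pow_succ, ← h2, inv_mul_cancel₀ hζ0]
  have hmdvd : m ∣ ℓ + 1 := (hprim.pow_eq_one_iff_dvd (ℓ + 1)).mp hζ1
  -- ### `[z, γ²] = c₀ [z, h₀] + [z, h₀] ≠ 0` for `z = x, y`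
  have hsq : c₀ * c₀ = 1 := by have h := hc₀.sq_eq_one; rwa [sq] at h
  have hcinv : c₀⁻¹ = c₀ := inv_eq_of_mul_eq_one_right hsq
  have hγγ : (c₀ * h₀ * u) * (c₀ * h₀ * u) = (c₀ * t * c₀⁻¹) * t := by
    rw [hγt, hcinv]; group
  have hconjT : c₀ * t * c₀⁻¹ ∈ torsionFixing W (2 : ℤ) := (torsionFixing_normal W _).conj_mem t htT c₀
  have hγγT : (c₀ * h₀ * u) * (c₀ * h₀ * u) ∈ torsionFixing W (2 : ℤ) := by
    rw [hγγ]; exact mul_mem hconjT htT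
  have hval : ∀ (z : galH1Torsion W (2 : ℤ)), h1Eval W (2 : ℤ) z u = 0 →
      c₀ • h1Eval W (2 : ℤ) z h₀ ≠ h1Eval W (2 : ℤ) z h₀ →
      h1Eval W (2 : ℤ) z ((c₀ * h₀ * u) * (c₀ * h₀ * u)) ≠ 0 := by
    intro z huz hh₀z
    rw [hγγ, h1Eval_mul W _ z hconjT, h1Eval_conj W _ z c₀ htT, ht, h1Eval_mul W _ z hh₀T, huz,
      add_zero]
    intro h0
    apply hh₀z
    have h2v : h1Eval W (2 : ℤ) z h₀ + h1Eval W (2 : ℤ) z h₀ = 0 := by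
      rw [← two_nsmul]; exact AddSubgroup.torsionBy.nsmul _
    rw [eq_neg_of_add_eq_zero_left h0, neg_eq_of_add_eq_zero_left h2v]
  -- ### the local criterion at `v`, then transport to `ℚ_ℓ`
  have hlocx := not_mem_torsionLocalKer_of_h1Eval_sq_ne_zero W (n := 2) two_ne_zero h𝔓₀ hγ hγγT
    (hval x hux hh₀x)
  have hlocy := not_mem_torsionLocalKer_of_h1Eval_sq_ne_zero W (n := 2) two_ne_zero h𝔓₀ hγ hγγT
    (hval y huy hh₀y)
  refine ⟨ℓ, hℓF, hℓB₀, hℓm, hmdvd, ⟨v, 𝔓₀, t, hvS', hℓv, h𝔓₀, hγt ▸ hγ, htTM, htA⟩,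
    fun hx'' ↦ hlocx ?_, fun hy'' ↦ hlocy ?_⟩
  · exact (mem_torsionLocalKer_padic_iff W θ (2 : ℤ) x).mp hx''
  · exact (mem_torsionLocalKer_padic_iff W θ (2 : ℤ) y).mp hy''

end DepthPair

end Summit.BirchSwinnertonDyer.BirchSwinnertonDyer.Theorems.GenusKolyTwistingPrime

end
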